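import Summits.PneNP.PneNP.Theses.PlantedClique
import Literature.Probability.RandomGraphs.PlantedCliqueUnique

/-!
# Route PlantedClique — `ErdosRenyiNoLargeClique` (stmt-PneNP-8686)

First-moment bound for the clique number of `G(n,1/2)`: if `k(n) ≥ (2+η) log₂ n` eventually (`η > 0`) then
`Pr[G(n,1/2) has a k(n)-clique] ≤ C(n,k)·2^{−⌊(k−1)/2⌋·k} ≤ (n·2^{−⌊(k−1)/2⌋})^k ≤ n·2^{−⌊(k−1)/2⌋} ≤ 2 n^{−η/2} → 0`.
The engine is the tree's `toOuterMeasure_forall_eq_true_le` (a fixed edge set is present with probability `≤ 2^{−|D|}`)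
and `card_sdiff_mul_le_two_mul_card_crossEdges` (a `k`-set spans `≥ k(k−1)/2 ≥ ⌊(k−1)/2⌋·k` edges), as in
`toOuterMeasure_not_isUniqueMaxClique_plant_le` of `PlantedCliqueUnique.lean`.
[Matula 1970; Grimmett–McDiarmid 1975; AlonKrivelevichSudakov1998 §1]
-/

set_option linter.dupNamespace false -- `Summit.PneNP.PneNP.…`: summit = sub-problem name (D-0017 single-conjunct layout)

namespace Summit.PneNP.PneNP.Theorems

open Filter Topology Finset
open scoped ENNReal
open Literature.Probability.RandomGraphs.PlantedClique

/-- **Union bound for `k`-cliques in `G(n,1/2)`**: `Pr[∃ k-clique] ≤ (n · 2^{−⌊(k−1)/2⌋})^k`. [folklore] -/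
theorem toOuterMeasure_exists_clique_le (n K : ℕ) :
    (erdosRenyiHalf n).toOuterMeasure
        {x | ∃ S : Finset (Fin n), S.card = K ∧ (graphOfEdgeVec x).IsClique (S : Set (Fin n))}
      ≤ ((n : ℝ≥0∞) * 2⁻¹ ^ ((K - 1) / 2)) ^ K := by
  classical
  set r : ℝ≥0∞ := 2⁻¹ ^ ((K - 1) / 2) with hr
  set 𝒯 := powersetCard K (univ : Finset (Fin n)) with h𝒯
  -- the edges spanned by `T` (as edge indicators of `K_n`)
  let cross : Finset (Fin n) → Finset (⊤ : SimpleGraph (Fin n)).edgeSet := fun T =>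
    Finset.filter (fun e : (⊤ : SimpleGraph (Fin n)).edgeSet =>
      Subtype.val e ∈ Finset.sym2 T ∧ Subtype.val e ∉ Finset.sym2 (∅ : Finset (Fin n))) Finset.univ
  have hclique : ∀ (T : Finset (Fin n)) (x : EdgeVec n),
      (graphOfEdgeVec x).IsClique (T : Set (Fin n)) → ∀ e ∈ cross T, x e = true := by
    intro T x hT
    rintro ⟨e, he⟩ hmem
    simp only [cross, mem_filter, mem_univ, true_and, Finset.mem_sym2_iff] at hmem
    obtain ⟨hT', -⟩ := hmem
    revert he hT'
    refine Sym2.ind (fun u v => ?_) e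
    intro he hT'
    have huv : u ≠ v := by simpa [SimpleGraph.mem_edgeSet] using he
    have hu : u ∈ T := hT' u (Sym2.mem_mk_left u v)
    have hv : v ∈ T := hT' v (Sym2.mem_mk_right u v)
    have hadj := hT (mem_coe.2 hu) (mem_coe.2 hv) huv
    rw [graphOfEdgeVec_adj] at hadj
    obtain ⟨_, hx⟩ := hadj
    exact hx
  have hsub : {x : EdgeVec n | ∃ S : Finset (Fin n), S.card = K ∧ (graphOfEdgeVec x).IsClique (S : Set (Fin n))}
      ⊆ ⋃ T ∈ 𝒯, {x | ∀ e ∈ cross T, x e = true} := by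
    rintro x ⟨S, hS, hSc⟩
    have hS𝒯 : S ∈ 𝒯 := by rw [h𝒯, mem_powersetCard]; exact ⟨subset_univ _, hS⟩
    exact Set.mem_biUnion hS𝒯 (hclique S x hSc)
  have hT_bound : ∀ T ∈ 𝒯, (erdosRenyiHalf n).toOuterMeasure {x | ∀ e ∈ cross T, x e = true} ≤ r ^ K := by
    intro T hT
    rw [h𝒯, mem_powersetCard] at hT
    obtain ⟨-, hTcard⟩ := hT
    refine (toOuterMeasure_forall_eq_true_le _).trans ?_
    rw [hr, ← pow_mul]
    refine pow_le_pow_of_le_one zero_le (ENNReal.inv_le_one.2 one_le_two) ?_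
    have h2 := card_sdiff_mul_le_two_mul_card_crossEdges (∅ : Finset (Fin n)) T
    rw [sdiff_empty, hTcard] at h2
    have hdiv : (K - 1) / 2 * 2 ≤ K - 1 := Nat.div_mul_le_self _ _
    calc (K - 1) / 2 * K ≤ (2 * (cross T).card) / 2 := by
          refine (Nat.le_div_iff_mul_le two_pos).2 ?_
          calc (K - 1) / 2 * K * 2 = K * ((K - 1) / 2 * 2) := by ring
            _ ≤ K * (K - 1) := Nat.mul_le_mul_left _ hdiv
            _ ≤ 2 * (cross T).card := h2
      _ = (cross T).card := by omega
  calc (erdosRenyiHalf n).toOuterMeasure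
        {x | ∃ S : Finset (Fin n), S.card = K ∧ (graphOfEdgeVec x).IsClique (S : Set (Fin n))}
      ≤ (erdosRenyiHalf n).toOuterMeasure (⋃ T ∈ 𝒯, {x | ∀ e ∈ cross T, x e = true}) :=
        (erdosRenyiHalf n).toOuterMeasure.mono hsub
    _ ≤ ∑ T ∈ 𝒯, (erdosRenyiHalf n).toOuterMeasure {x | ∀ e ∈ cross T, x e = true} :=
        MeasureTheory.measure_biUnion_finset_le _ _
    _ ≤ ∑ _T ∈ 𝒯, r ^ K := sum_le_sum hT_bound
    _ = (n.choose K : ℝ≥0∞) * r ^ K := by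
        rw [sum_const, nsmul_eq_mul, h𝒯, card_powersetCard, card_univ, Fintype.card_fin]
    _ ≤ ((n ^ K : ℕ) : ℝ≥0∞) * r ^ K := by gcongr; exact Nat.choose_le_pow _ _
    _ = ((n : ℝ≥0∞) * r) ^ K := by push_cast; ring

/-- **Support item `ErdosRenyiNoLargeClique` of route PlantedClique (stmt-PneNP-8686)**: if `k(n) ≥ (2+η) log₂ n`
eventually for some `η > 0` then `Pr[G(n,1/2) contains a k(n)-clique] → 0` (first moment:
`≤ (n·2^{−⌊(k−1)/2⌋})^k ≤ 2 n^{−η/2}`). [cite: AlonKrivelevichSudakov1998, §1]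
[cite: BarakHopkinsKelnerKothariMoitraPotechin2019, §1 Rem. 1.2] -/
theorem plantedClique_erdosRenyiNoLargeClique_proof :
    Summit.PneNP.PneNP.Theses.PlantedClique.ErdosRenyiNoLargeClique := by
  unfold Summit.PneNP.PneNP.Theses.PlantedClique.ErdosRenyiNoLargeClique
  rintro k ⟨η, hη, hk⟩
  -- the real bound `n · 2^{−⌊(k−1)/2⌋} → 0`
  have hlog : 0 < Real.log 2 := Real.log_pos one_lt_two
  have hB : Tendsto (fun n : ℕ => (n : ℝ) * 2⁻¹ ^ ((k n - 1) / 2)) atTop (𝓝 0) := by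
    have hlim : Tendsto (fun n : ℕ => 2 * (n : ℝ) ^ (-(η / 2))) atTop (𝓝 0) := by
      have h := ((tendsto_rpow_neg_atTop (by positivity : 0 < η / 2)).comp tendsto_natCast_atTop_atTop).const_mul 2
      rw [mul_zero] at h
      exact h
    refine squeeze_zero' (Eventually.of_forall fun n => by positivity) ?_ hlim
    filter_upwards [hk, eventually_ge_atTop 1] with n hkn hn
    have hnpos : (0 : ℝ) < n := by exact_mod_cast hn
    set m := (k n - 1) / 2 with hm
    have h2m : (k n : ℝ) ≤ 2 * m + 2 := by
      have : k n ≤ 2 * m + 2 := by omega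
      exact_mod_cast this
    have hpow : (2⁻¹ : ℝ) ^ m = Real.exp (-(Real.log 2 * m)) := by
      rw [Real.exp_neg, mul_comm, Real.exp_nat_mul, Real.exp_log two_pos, inv_pow]
    have h1 : (2 + η) * Real.log n ≤ (2 * m + 2) * Real.log 2 := by
      have h' : (2 + η) * Real.logb 2 n ≤ 2 * m + 2 := hkn.trans h2m
      have : (2 + η) * Real.logb 2 n = (2 + η) * Real.log n / Real.log 2 := by
        rw [Real.logb, mul_div_assoc]
      rw [this, div_le_iff₀ hlog] at h'
      exact h'
    have hkey : -(Real.log 2 * m) ≤ Real.log 2 - (1 + η / 2) * Real.log n := by linarith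
    rw [hpow]
    calc (n : ℝ) * Real.exp (-(Real.log 2 * m)) ≤ (n : ℝ) * Real.exp (Real.log 2 - (1 + η / 2) * Real.log n) := by
          gcongr
      _ = 2 * (n : ℝ) ^ (-(η / 2)) := by
          have e1 : Real.exp ((1 + η / 2) * Real.log n) = (n : ℝ) ^ (1 + η / 2) := by
            rw [Real.rpow_def_of_pos hnpos, mul_comm]
          have e2 : (n : ℝ) ^ (-(η / 2)) = (n : ℝ) / (n : ℝ) ^ (1 + η / 2) := by
            rw [show (-(η / 2) : ℝ) = 1 - (1 + η / 2) by ring, Real.rpow_sub hnpos, Real.rpow_one]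
          rw [Real.exp_sub, Real.exp_log two_pos, e1, e2]
          ring
  -- in `ℝ≥0∞`
  have hconv : ∀ n : ℕ, (n : ℝ≥0∞) * 2⁻¹ ^ ((k n - 1) / 2) = ENNReal.ofReal ((n : ℝ) * 2⁻¹ ^ ((k n - 1) / 2)) := by
    intro n
    rw [ENNReal.ofReal_mul (Nat.cast_nonneg _), ENNReal.ofReal_natCast, ENNReal.ofReal_pow (by norm_num),
      ENNReal.ofReal_inv_of_pos two_pos, ENNReal.ofReal_ofNat]
  have hBenn : Tendsto (fun n : ℕ => (n : ℝ≥0∞) * 2⁻¹ ^ ((k n - 1) / 2)) atTop (𝓝 0) := by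
    have h := ENNReal.tendsto_ofReal hB
    rw [ENNReal.ofReal_zero] at h
    exact h.congr fun n => (hconv n).symm
  -- eventually `1 ≤ k n` and the bound is `≤ 1`
  have hk1 : ∀ᶠ n : ℕ in atTop, 1 ≤ k n := by
    filter_upwards [hk, eventually_ge_atTop 2] with n hkn hn
    have hn' : (2 : ℝ) ≤ n := by exact_mod_cast hn
    have hlogb : 1 ≤ Real.logb 2 (n : ℝ) := by
      rw [Real.le_logb_iff_rpow_le one_lt_two (by linarith), Real.rpow_one]
      exact hn'
    have : (1 : ℝ) ≤ k n := le_trans (by nlinarith) hkn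
    exact_mod_cast this
  have hB1 : ∀ᶠ n : ℕ in atTop, (n : ℝ≥0∞) * 2⁻¹ ^ ((k n - 1) / 2) ≤ 1 :=
    hBenn.eventually (ge_mem_nhds one_pos)
  refine tendsto_of_tendsto_of_tendsto_of_le_of_le' tendsto_const_nhds hBenn
    (Eventually.of_forall fun n => zero_le) ?_
  filter_upwards [hk1, hB1] with n hk1n hB1n
  calc (erdosRenyiHalf n).toOuterMeasure
        {x | ∃ S : Finset (Fin n), S.card = k n ∧ (graphOfEdgeVec x).IsClique (S : Set (Fin n))}
      ≤ ((n : ℝ≥0∞) * 2⁻¹ ^ ((k n - 1) / 2)) ^ (k n) := toOuterMeasure_exists_clique_le n (k n)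
    _ ≤ (n : ℝ≥0∞) * 2⁻¹ ^ ((k n - 1) / 2) := pow_le_of_le_one zero_le hB1n (by omega)

end Summit.PneNP.PneNP.Theorems
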